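import Summits.NavierStokesRegularity.NavierStokesRegularity.Theses.PalasekTowerBreakdown
import Summits.NavierStokesRegularity.FluidComputer.PalasekTowerGermHost

/-!
# `EpisodeBase` BY NAME for a named GERM design: the crux reduces to ONE episode of the germ schedule

Cell `ns-blowup`, seat `ns-blowup-ecbridge-3` (g3); GROUP C «BRIDGE SUPPORT» of the route
`PalasekTowerBreakdown`, crux `EpisodeBase` (item stmt-NavierStokesRegularity-19179, R2 of record:
`EpisodeBase ↔ ∃ S*, HostPreparationD (HostClass.exact S*) ∧ FirstEpisodeD (HostClass.exact S*)`,
`palasekTowerBreakdown_episodeBase_iff_exists_exact`, p433545). LABEL: E–C typing (KERNEL, proofs only,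
by name). WHAT THIS IS NOT: not Navier–Stokes evidence — conditionals whose hypotheses are the OPEN
episode of a named design; nothing is asserted about any flow after `τ₀`, about `RungG 1` or blow-up.
HELPER for 19179 (`--supports`), closes nothing.

With the germ host (`Germ.LevelZeroData.hostPreparationD_exact`, `FluidComputer/PalasekTowerGermHost`,
p443639) the FIRST child of the split holds for the germ schedule `S* = h.schedule c₄` of EVERY profile
`U` in the slot `Germ.LevelZeroData U ρ` (three level-`0` readouts + the strict first-order anchor
test). Hence, BY NAME:

* `…_of_germ_firstEpisodeD`: `EpisodeBase ⇐ FirstEpisodeD (HostClass.exact (h.schedule c₄ …))`;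
* `…_of_germ_levelWitness`: `EpisodeBase ⇐ (h.schedule c₄ …).LevelWitness 1 0` — ONE classical
  finite-energy flow of the germ schedule (zero datum, the schedule's own faded force, no re-push)
  reaching `τ₁` below `(5/3)Y₁` on the window and showing the three level-`1` floors at `τ₁`;
* `…_of_germ_repush_levelWitness`: the same after an admissible RE-PUSH chosen by the designer on the
  window (`c ≤ 1`, Clay class, `= S*.f` on `[0, τ₀]`, confined, silent from `τ₁`), the re-pushed
  schedule's pins/rigidity/quietness being automatic (`Schedule.Rigid.pins_repush_of_le_c₁`).

References: S. Palasek, arXiv:2605.13827 §4 (Step 2) [cite: Palasek2026ElementaryModel, §4];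
H. Sohr, *The Navier–Stokes Equations* (2001), Ch. V Thm. 1.5.1 [cite: Sohr2001, Ch. V Thm. 1.5.1].
-/

noncomputable section

-- `Summit.<Summit>.<Problem>` is the tree's mandated summit-side namespace (CONVENTIONS §2); for this
-- single-conjunct summit the two coincide, so the duplicate is deliberate.
set_option linter.dupNamespace false

namespace Summit.NavierStokesRegularity.NavierStokesRegularity.Theorems

open Set Function
open Summit.NavierStokesRegularity.FluidComputer.PalasekTowerClayBridge
open Summit.NavierStokesRegularity.FluidComputer.PalasekTowerClayBridge.Germ
open Literature.Analysis.FluidPDE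

variable {U : EuclideanSpace ℝ (Fin 3) → EuclideanSpace ℝ (Fin 3)} {ρ : ℝ}

/-- **`EpisodeBase` from the EPISODE of a named germ design**: for a profile `U` in the slot and a push
constant `c₄ ∈ (0, 1]`, the first episode over the singleton class of the germ schedule gives the
route's crux by name (host preparation being the germ host theorem). [cite: Palasek2026ElementaryModel, §4] -/
theorem palasekTowerBreakdown_episodeBase_of_germ_firstEpisodeD (h : LevelZeroData U ρ) {c₄ : ℝ}
    (hc₄ : 0 < c₄) (hc₄' : c₄ ≤ 1)
    (hF : FirstEpisodeD (HostClass.exact (h.schedule c₄ hc₄ hc₄'))) :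
    Summit.NavierStokesRegularity.NavierStokesRegularity.Theses.PalasekTowerBreakdown.EpisodeBase :=
  h.episodeBaseG_of_firstEpisodeD hc₄ hc₄' hF

/-- **`EpisodeBase` from ONE LEVEL WITNESS of the germ schedule** (no re-push: the design keeps its own
faded force): a classical finite-energy solution of the germ schedule's forced system on `[0, τ₁]`
from the zero datum, below `(5/3)Y₁` on `[τ₀, τ₁]`, with the speed floor `Y₁`, the strain floor `A₁`
and an `N₁`-core loop in the ball at `τ₁`, closes the crux for this design
(`firstEpisodeD_exact_of_levelWitness_self`). [cite: Sohr2001, Ch. V Thm. 1.5.1] -/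
theorem palasekTowerBreakdown_episodeBase_of_germ_levelWitness (h : LevelZeroData U ρ) {c₄ : ℝ}
    (hc₄ : 0 < c₄) (hc₄' : c₄ ≤ 1) (hW : (h.schedule c₄ hc₄ hc₄').LevelWitness 1 0) :
    Summit.NavierStokesRegularity.NavierStokesRegularity.Theses.PalasekTowerBreakdown.EpisodeBase :=
  palasekTowerBreakdown_episodeBase_of_germ_firstEpisodeD h hc₄ hc₄'
    (firstEpisodeD_exact_of_levelWitness_self (h.schedule_pins hc₄ hc₄') (h.schedule_rigid hc₄ hc₄')
      (h.schedule_quiet hc₄ hc₄') hW)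

/-- **`EpisodeBase` from a level witness of a RE-PUSHED germ schedule**: the designer may replace the
force on the window by any admissible push `g` (Clay class, `c ≤ 1`, `‖g‖ ≤ c Y_k` on the windows,
silent from the blow-up time, EQUAL to the germ schedule's force on `[0, τ₀]`, confined to the ball,
zero from `τ₁` on); the re-pushed schedule is again pinned, rigid and quiet, and one level witness of
it at level `0` closes the crux for the re-pushed design (`firstEpisodeD_exact_of_levelWitness`).
[cite: Sohr2001, Ch. V Thm. 1.5.1] -/
theorem palasekTowerBreakdown_episodeBase_of_germ_repush_levelWitness (h : LevelZeroData U ρ)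
    {c₄ : ℝ} (hc₄ : 0 < c₄) (hc₄' : c₄ ≤ 1) {c : ℝ} (hc : c ≤ (h.schedule c₄ hc₄ hc₄').c₁)
    {g : ℝ → EuclideanSpace ℝ (Fin 3) → EuclideanSpace ℝ (Fin 3)}
    (h₁ : IsSmoothOnHalfSpace g) (h₂ : HasRapidSpaceTimeDecay g)
    (h₃ : ∀ t, (h.schedule c₄ hc₄ hc₄').T ≤ t → ∀ x, g t x = 0)
    (h₄ : ∀ k, ∀ t ∈ Icc ((h.schedule c₄ hc₄ hc₄').τ k) ((h.schedule c₄ hc₄ hc₄').τ (k + 1)), ∀ x,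
      ‖g t x‖ ≤ c * TowerRates.wide.Y k)
    (hg : ∀ t ∈ Icc 0 ((h.schedule c₄ hc₄ hc₄').τ 0), ∀ x, g t x = (h.schedule c₄ hc₄ hc₄').f t x)
    (hgρ : ∀ t x, (h.schedule c₄ hc₄ hc₄').radius < ‖x‖ → g t x = 0)
    (hgq : ∀ t, (h.schedule c₄ hc₄ hc₄').τ 1 ≤ t → g t = 0)
    (hW : ((h.schedule c₄ hc₄ hc₄').repush c hc g h₁ h₂ h₃ h₄).LevelWitness 1 0) :
    Summit.NavierStokesRegularity.NavierStokesRegularity.Theses.PalasekTowerBreakdown.EpisodeBase := by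
  have hR := h.schedule_rigid hc₄ hc₄'
  have hP := h.schedule_pins hc₄ hc₄'
  exact palasekTowerBreakdown_episodeBase_of_germ_firstEpisodeD h hc₄ hc₄'
    (firstEpisodeD_exact_of_levelWitness hc h₁ h₂ h₃ h₄ hg (hR.pins_repush_of_le_c₁ hP hgρ)
      (Schedule.Rigid.repush hR) ((Schedule.repush_quiet_iff).2 hgq) hW)

/-- **What remains of the crux for a germ design, by name**: `EpisodeBase` holds as soon as SOME profile
in the slot, at SOME push constant, has its first episode — the R2 split with its first child
discharged. [cite: Palasek2026ElementaryModel, §4] -/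
theorem palasekTowerBreakdown_episodeBase_of_exists_germ_firstEpisodeD
    (hex : ∃ (U : EuclideanSpace ℝ (Fin 3) → EuclideanSpace ℝ (Fin 3)) (ρ c₄ : ℝ)
      (h : LevelZeroData U ρ) (hc₄ : 0 < c₄) (hc₄' : c₄ ≤ 1),
        FirstEpisodeD (HostClass.exact (h.schedule c₄ hc₄ hc₄'))) :
    Summit.NavierStokesRegularity.NavierStokesRegularity.Theses.PalasekTowerBreakdown.EpisodeBase := by
  obtain ⟨U, ρ, c₄, h, hc₄, hc₄', hF⟩ := hex
  exact palasekTowerBreakdown_episodeBase_of_germ_firstEpisodeD h hc₄ hc₄' hF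

end Summit.NavierStokesRegularity.NavierStokesRegularity.Theorems

end
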